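import Summits.QuantumFields.YangMills.Theorems.SwapVirialDeficitSectorLaplaceEndCoreAssembly
import HarnessLib

/-!
# THE BULK'S MORSE–BOTT MAIN TERM IN THE HUB LETTER `δ`, THE SHELL FLOOR, AND THE RESCALED FIBRE CEILING — inputs of `stub_end_gaussCore`
# (free-hands support of ⟨stmt-QuantumFields-24197⟩ `SwapVirialDeficit.SwapGluedStiffness`; LEAD g99 memo11, 2026-08-31 ≥ 22:40Z)

Both sides of the matched comparison `hG♭` (✓`stub_core_end_of_gaussCore`) live on the hub letter `δ = re a/‖im a‖` with the SAME weight `((1+δ²)⁻¹)²` and the SAME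
prefactor `coneConst·π`: the slab side by ✓`setLIntegral_endCore_eq_hubCot`, the bulk side by this file.
* §1 ★ `abs_fibQ_gnoScale_le` — the fibre form in w2 g59's RESCALED letters is bounded UNIFORMLY over the base plane: `|Q_{a,ε,p}(gnoScale p y)| ≤ 20400L⁴‖y‖²`
  (g47's ✓`taylor_four_chartDeficit_gnomonic` with the normalised letter sizes ✓`letterSizes_rescaled_le`; the unscaled ✓`abs_fibQ_le` loses `(1+x₀²)(1+y₀²)` at the
  gnomonic ends).  With ✓`gnoFibre_rescaled_sockets` (`𝔪 = (1+x₀²)⁻¹(1+y₀²)⁻¹/√det A′`) this is the ceiling the rescaled converter `𝔪 ≥ (1+x₀²)⁻¹(1+y₀²)⁻¹·poly⁻¹·det A_F^{−1/2}` needs.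
* §2 `fibQ_eq_hubCot`, `mbDensity_eq_hubCot`, `mem_hubBulk_iff_cot` — the Morse–Bott density and the bulk hubs depend on the hub only through `δ`.
* §3 `measurable_planeMass_hubAt`, ★★ `lintegral_planeMass_hubBulk_eq_hubCot`, ★★ `setIntegral_planeMass_hubBulk_eq_hubCot`:
  `∫_{HubBulk τ}∫_{ℝ²}𝔪_ε dcone = coneConst·π·∫_{δ : τ ≤ 4δ²/(1+δ²)² ∧ τ ≤ (1+δ²)⁻¹} ((1+δ²)⁻¹)²·∫_{ℝ²}𝔪(hubAt δ 1, ε, ·) dδ` (✓`lintegral_coneMeasure_hubCot`).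
* §4 `endShell_subset_bulkWindow`, `integrableOn_planeMass_hubCot`, ★ `mbMain_ge_of_subset` — the SHELL FLOOR: for any measurable `S` inside the bulk window,
  `coneConst·π·∫_S ((1+δ²)⁻¹)²·∫𝔪(hubAt δ 1) ≤ ∫_{HubBulk τ}∫𝔪` (the adjacent shell `{τ ≤ 4δ²/(1+δ²)², |δ| ≤ r}`, `r ≤ 1`, `τ ≤ ½`, is such an `S`).

HONEST LABEL: bookkeeping; `stub_end_gaussCore` (hence `stub_core_end`), stubs core-tip ∕ 001-good of ➎, ⟨24197⟩ ∕ ⟨24194⟩ OPEN; own crux ⟨22884⟩ `LargeFieldMassRefinementTail`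
OPEN (blocked-on ⟨19935⟩); the Yang–Mills mass gap is NOT proved; no summit is proved by a line.  THEOREMS ONLY (0 `def`, 0 `sorry`), standard axioms; the series' local
`ℍ` instances.  LEAD seat ym-line-sfw-p2 g99 (cell ym-idea-1, free hands), `--supports stmt-QuantumFields-24197`.  References: [cite: Luscher1983, §2]; [folklore].
-/

set_option autoImplicit false
set_option synthInstance.maxSize 1024

noncomputable section

open MeasureTheory Quaternion Set
open scoped Quaternion BigOperators ENNReal
open Literature.MathematicalPhysics.QuantumLattice
open Literature.MathematicalPhysics.QuantumFieldTheory hiding SU2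
open Summit.QuantumFields.YangMills.Theorems.SwapTwistDeficit.ToronLog

attribute [local instance] Literature.Analysis.FluidPDE.Tao2016.quatMeasurableSpace
  Literature.Analysis.FluidPDE.Tao2016.quatBorelSpace
  Literature.MathematicalPhysics.QuantumLattice.secondCountableTopology_su2

namespace Summit.QuantumFields.YangMills.Theorems.SwapVirialDeficit.SectorLaplace

open Summit.QuantumFields.YangMills.Theorems.FemtoTransferGap
open Summit.QuantumFields.YangMills.Theorems.FemtoTransferGap.TT
open Summit.QuantumFields.YangMills.Theorems.VirialFluxGap.RingDeficit
open Summit.QuantumFields.YangMills.Theorems.SwapVirialDeficit.SwapRing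
open Summit.QuantumFields.YangMills.Theorems.SwapVirialDeficit.BlowUpRing

variable {L : ℕ} [NeZero L]

/-! ## §1 The fibre form is bounded uniformly in the rescaled letters -/

/-- ★ **THE RESCALED CEILING**: `|Q_{a,ε,p}(gnoScale p y)| ≤ 20400·L⁴·‖y‖²` for every hub `a ≠ 0`, all signs, EVERY base point `p` (the normalised letter sizes of the
rescaled point are `≤ ‖y‖`, ✓`letterSizes_rescaled_le`; second jet of ✓`taylor_four_chartDeficit_gnomonic` along the Euler ray = the fibre ray). [cite: Luscher1983, §2] -/
theorem abs_fibQ_gnoScale_le {a : ℍ} (ha : a ≠ 0) (ε : GnoSign L) (p : ℝ × ℝ) (y : GnoFibre L) :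
    |fibQ a ε p (gnoScale p y)| ≤ 20400 * (L : ℝ) ^ 4 * ‖y‖ ^ 2 := by
  obtain ⟨hx, hy, hz, hf⟩ := letterSizes_rescaled_le p y
  have h := ((Gnomonic.taylor_four_chartDeficit_gnomonic z₀ (fun _ => 1) ha ε (gnoFibreEquiv (p, gnoScale p y)) (norm_nonneg y) hx hy hz hf).1 0).2.1
  have eray : (fun t : ℝ => chartDeficit L z₀ (fun _ => 1) (blowUpPoint t (gnomonicPoint a ε (gnoFibreEquiv (p, gnoScale p y))))) =
      fun t : ℝ => gnoDeficit z₀ (fun _ => 1) a ε (gnoBase p.1 p.2 + t • gnoFibreEmb (gnoScale p y)) := funext fun t => by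
    rw [← gnoDeficit_eulerDilate, gnoBase_add_smul_eq_eulerDilate]
  rw [eray] at h
  unfold fibQ
  exact h

/-! ## §2 The Morse–Bott density and the bulk hubs in the letter `δ` -/

/-- `Q_{a,ε,p} = Q_{hubAt δ 1, ε, p}`, `δ = re a/‖im a‖` (`im a ≠ 0`; ✓`gnoDeficit_eq_hubCot`). [folklore] -/
theorem fibQ_eq_hubCot {a : ℍ} (him : a.im ≠ 0) (ε : GnoSign L) (p : ℝ × ℝ) (y : GnoFibre L) :
    fibQ a ε p y = fibQ (hubAt (a.re / ‖a.im‖) 1) ε p y := by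
  unfold fibQ
  simp_rw [gnoDeficit_eq_hubCot z₀ (fun _ => 1) him]

/-- `𝔪(a, ε, p) = 𝔪(hubAt δ 1, ε, p)` (`im a ≠ 0`). [folklore] -/
theorem mbDensity_eq_hubCot {a : ℍ} (him : a.im ≠ 0) (ε : GnoSign L) (p : ℝ × ℝ) :
    mbDensity (L := L) a ε p = mbDensity (hubAt (a.re / ‖a.im‖) 1) ε p := by
  unfold mbDensity
  simp_rw [fibQ_eq_hubCot him]

/-- ★ **THE BULK HUBS IN THE LETTER `δ`**: for `im a ≠ 0`, `a ∈ HubBulk τ ↔ τ ≤ 4δ²/(1+δ²)² ∧ τ ≤ (1+δ²)⁻¹` (✓`hubS1_eq_cot`, ✓`hubS2_eq_cot`). [folklore] -/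
theorem mem_hubBulk_iff_cot {a : ℍ} (him : a.im ≠ 0) (τ : ℝ) :
    a ∈ HubBulk τ ↔ τ ≤ 4 * (a.re / ‖a.im‖) ^ 2 / (1 + (a.re / ‖a.im‖) ^ 2) ^ 2 ∧ τ ≤ (1 + (a.re / ‖a.im‖) ^ 2)⁻¹ := by
  have ha : a ≠ 0 := fun h => him (by rw [h]; rfl)
  simp only [HubBulk, mem_setOf_eq, hubS1_eq_cot him, hubS2_eq_cot him]
  exact ⟨fun h => ⟨h.2.1, h.2.2⟩, fun h => ⟨ha, h.1, h.2⟩⟩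

/-! ## §3 The main term as a `δ`-integral -/

/-- `(δ, p) ↦ 𝔪(hubAt δ 1, ε, p)` is jointly measurable (✓`measurable_mbDensity_hubFix`, `hubAt δ 1 ≠ 0`). [folklore] -/
theorem measurable_mbDensity_hubAt (ε : GnoSign L) : Measurable fun q : ℝ × (ℝ × ℝ) => mbDensity (L := L) (hubAt q.1 1) ε q.2 := by
  have hh : Measurable fun q : ℝ × (ℝ × ℝ) => (hubAt q.1 1, q.2) :=
    (measurable_hubAt.comp (measurable_fst.prodMk measurable_const)).prodMk measurable_snd
  have h := (measurable_mbDensity_hubFix (L := L) ε).comp hh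
  convert h using 1
  funext q
  simp only [Function.comp_apply]
  rw [if_neg (hubAt_one_ne_zero q.1)]

/-- `δ ↦ ∫_{ℝ²} 𝔪(hubAt δ 1, ε, ·)` is measurable. [folklore] -/
theorem measurable_planeMass_hubAt (ε : GnoSign L) : Measurable fun δ : ℝ => ∫ p : ℝ × ℝ, mbDensity (L := L) (hubAt δ 1) ε p := by
  have h := (measurable_mbDensity_hubAt (L := L) ε).stronglyMeasurable.integral_prod_right' (ν := (volume : Measure (ℝ × ℝ)))
  exact h.measurable

omit [NeZero L] in
/-- The bulk window in the letter `δ` is measurable. [folklore] -/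
theorem measurableSet_bulkWindow (τ : ℝ) : MeasurableSet {δ : ℝ | τ ≤ 4 * δ ^ 2 / (1 + δ ^ 2) ^ 2 ∧ τ ≤ (1 + δ ^ 2)⁻¹} := by
  have ha : Measurable fun δ : ℝ => 4 * δ ^ 2 / (1 + δ ^ 2) ^ 2 :=
    ((measurable_id.pow_const 2).const_mul 4).div ((measurable_const.add (measurable_id.pow_const 2)).pow_const 2)
  have hb : Measurable fun δ : ℝ => (1 + δ ^ 2)⁻¹ := (measurable_const.add (measurable_id.pow_const 2)).inv
  exact (measurableSet_le measurable_const ha).inter (measurableSet_le measurable_const hb)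

/-- ★★ **THE MAIN TERM IN THE LETTER `δ`** (`ℝ≥0∞` form):
`∫⁻_{HubBulk τ} ofReal(∫𝔪(a,ε,·)) dcone = coneConst·π·∫⁻_{δ-window} ofReal(∫𝔪(hubAt δ 1,ε,·))·ofReal(((1+δ²)⁻¹)²) dδ` (✓`lintegral_coneMeasure_hubCot`). [folklore] -/
theorem lintegral_planeMass_hubBulk_eq_hubCot (ε : GnoSign L) (τ : ℝ) :
    ∫⁻ a in HubBulk τ, ENNReal.ofReal (∫ p : ℝ × ℝ, mbDensity (L := L) a ε p) ∂coneMeasure =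
      ENNReal.ofReal (coneConst * Real.pi) *
        ∫⁻ δ in {δ : ℝ | τ ≤ 4 * δ ^ 2 / (1 + δ ^ 2) ^ 2 ∧ τ ≤ (1 + δ ^ 2)⁻¹},
          ENNReal.ofReal (∫ p : ℝ × ℝ, mbDensity (L := L) (hubAt δ 1) ε p) * ENNReal.ofReal (((1 + δ ^ 2)⁻¹) ^ 2) := by
  have hWm : MeasurableSet {δ : ℝ | τ ≤ 4 * δ ^ 2 / (1 + δ ^ 2) ^ 2 ∧ τ ≤ (1 + δ ^ 2)⁻¹} := measurableSet_bulkWindow τ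
  have hGm : Measurable ({δ : ℝ | τ ≤ 4 * δ ^ 2 / (1 + δ ^ 2) ^ 2 ∧ τ ≤ (1 + δ ^ 2)⁻¹}.indicator
      fun δ : ℝ => ENNReal.ofReal (∫ p : ℝ × ℝ, mbDensity (L := L) (hubAt δ 1) ε p)) :=
    (measurable_planeMass_hubAt (L := L) ε).ennreal_ofReal.indicator hWm
  -- the hub integrand is a.e. a function of `δ`
  have hae : (fun a : ℍ => (HubBulk τ).indicator (fun a => ENNReal.ofReal (∫ p : ℝ × ℝ, mbDensity (L := L) a ε p)) a) =ᵐ[coneMeasure]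
      fun a : ℍ => ({δ : ℝ | τ ≤ 4 * δ ^ 2 / (1 + δ ^ 2) ^ 2 ∧ τ ≤ (1 + δ ^ 2)⁻¹}.indicator
        fun δ : ℝ => ENNReal.ofReal (∫ p : ℝ × ℝ, mbDensity (L := L) (hubAt δ 1) ε p)) (a.re / ‖a.im‖) := by
    filter_upwards [ae_re_ne_zero_im_ne_zero_coneMeasure] with a ha
    have hpm : (∫ p : ℝ × ℝ, mbDensity (L := L) a ε p) = ∫ p : ℝ × ℝ, mbDensity (L := L) (hubAt (a.re / ‖a.im‖) 1) ε p :=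
      integral_congr_ae (Filter.Eventually.of_forall fun p => mbDensity_eq_hubCot ha.2 ε p)
    by_cases hb : a ∈ HubBulk τ
    · have hb' : a.re / ‖a.im‖ ∈ {δ : ℝ | τ ≤ 4 * δ ^ 2 / (1 + δ ^ 2) ^ 2 ∧ τ ≤ (1 + δ ^ 2)⁻¹} := (mem_hubBulk_iff_cot ha.2 τ).1 hb
      rw [indicator_of_mem hb, indicator_of_mem hb', hpm]
    · have hb' : a.re / ‖a.im‖ ∉ {δ : ℝ | τ ≤ 4 * δ ^ 2 / (1 + δ ^ 2) ^ 2 ∧ τ ≤ (1 + δ ^ 2)⁻¹} :=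
        fun h => hb ((mem_hubBulk_iff_cot ha.2 τ).2 h)
      rw [indicator_of_notMem hb, indicator_of_notMem hb']
  rw [← lintegral_indicator (measurableSet_hubBulk τ), lintegral_congr_ae hae, lintegral_coneMeasure_hubCot _ hGm, ← lintegral_indicator hWm]
  congr 1
  refine lintegral_congr fun δ => ?_
  by_cases hδ : δ ∈ {δ : ℝ | τ ≤ 4 * δ ^ 2 / (1 + δ ^ 2) ^ 2 ∧ τ ≤ (1 + δ ^ 2)⁻¹}
  · rw [indicator_of_mem hδ, indicator_of_mem hδ]
  · rw [indicator_of_notMem hδ, indicator_of_notMem hδ, zero_mul]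

/-- ★★ **THE MAIN TERM IN THE LETTER `δ`** (Bochner form, no hypothesis):
`∫_{HubBulk τ}∫𝔪_ε dcone = coneConst·π·∫_{δ : τ ≤ 4δ²/(1+δ²)² ∧ τ ≤ (1+δ²)⁻¹} ((1+δ²)⁻¹)²·∫𝔪(hubAt δ 1, ε, ·) dδ`. [folklore] -/
theorem setIntegral_planeMass_hubBulk_eq_hubCot (ε : GnoSign L) (τ : ℝ) :
    ∫ a in HubBulk τ, (∫ p : ℝ × ℝ, mbDensity (L := L) a ε p) ∂coneMeasure =
      coneConst * Real.pi *
        ∫ δ in {δ : ℝ | τ ≤ 4 * δ ^ 2 / (1 + δ ^ 2) ^ 2 ∧ τ ≤ (1 + δ ^ 2)⁻¹},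
          ((1 + δ ^ 2)⁻¹) ^ 2 * ∫ p : ℝ × ℝ, mbDensity (L := L) (hubAt δ 1) ε p := by
  have hpm0 : ∀ a : ℍ, 0 ≤ ∫ p : ℝ × ℝ, mbDensity (L := L) a ε p := fun a => integral_nonneg fun p => mbDensity_nonneg a ε p
  have hm1 : AEStronglyMeasurable (fun a : ℍ => ∫ p : ℝ × ℝ, mbDensity (L := L) a ε p) (coneMeasure.restrict (HubBulk τ)) := by
    -- a.e. equal to the measurable `δ`-function composed with `a ↦ re a/‖im a‖`
    have hcot : Measurable fun a : ℍ => a.re / ‖a.im‖ :=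
      (Quaternion.continuous_re.measurable).div (continuous_norm.measurable.comp Quaternion.continuous_im.measurable)
    have hg : Measurable fun a : ℍ => ∫ p : ℝ × ℝ, mbDensity (L := L) (hubAt (a.re / ‖a.im‖) 1) ε p :=
      (measurable_planeMass_hubAt (L := L) ε).comp hcot
    refine (hg.aestronglyMeasurable.congr ?_).restrict
    filter_upwards [ae_re_ne_zero_im_ne_zero_coneMeasure] with a ha
    exact integral_congr_ae (Filter.Eventually.of_forall fun p => (mbDensity_eq_hubCot ha.2 ε p).symm)
  have hm2 : Measurable fun δ : ℝ => ((1 + δ ^ 2)⁻¹) ^ 2 * ∫ p : ℝ × ℝ, mbDensity (L := L) (hubAt δ 1) ε p :=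
    (((measurable_const.add (measurable_id.pow_const 2)).inv).pow_const 2).mul (measurable_planeMass_hubAt ε)
  rw [integral_eq_lintegral_of_nonneg_ae (Filter.Eventually.of_forall fun a => hpm0 a) hm1,
    integral_eq_lintegral_of_nonneg_ae (Filter.Eventually.of_forall fun δ => mul_nonneg (by positivity) (hpm0 _)) hm2.aestronglyMeasurable.restrict,
    lintegral_planeMass_hubBulk_eq_hubCot ε τ, ENNReal.toReal_mul, ENNReal.toReal_ofReal (mul_pos coneConst_pos Real.pi_pos).le]
  congr 2
  refine lintegral_congr fun δ => ?_
  rw [← ENNReal.ofReal_mul (hpm0 _), mul_comm]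

/-! ## §4 The shell floor -/

/-- The END's adjacent bulk shell `{τ ≤ 4δ²/(1+δ²)², |δ| ≤ r}` (`r ≤ 1`, `τ ≤ ½`) lies in the bulk window. [folklore] -/
theorem endShell_subset_bulkWindow {τ r : ℝ} (hτ2 : τ ≤ 1 / 2) (hr : r ≤ 1) :
    {δ : ℝ | τ ≤ 4 * δ ^ 2 / (1 + δ ^ 2) ^ 2 ∧ |δ| ≤ r} ⊆ {δ : ℝ | τ ≤ 4 * δ ^ 2 / (1 + δ ^ 2) ^ 2 ∧ τ ≤ (1 + δ ^ 2)⁻¹} := by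
  intro δ hδ
  refine ⟨hδ.1, hτ2.trans ?_⟩
  have h1 : δ ^ 2 ≤ 1 := by
    have h := (abs_le.1 (hδ.2.trans hr))
    nlinarith [h.1, h.2]
  rw [le_inv_comm₀ (by norm_num) (by positivity)]
  norm_num
  linarith

/-- The `δ`-integrand of the main term is integrable on the bulk window (good `ε`, `0 < τ ≤ 1`; ✓`integrableOn_integral_mbDensity_hubBulk`). [folklore] -/
theorem integrableOn_planeMass_hubCot {ε : GnoSign L} (hε : GoodSign ε) {τ : ℝ} (hτ : 0 < τ) (hτ1 : τ ≤ 1) :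
    IntegrableOn (fun δ : ℝ => ((1 + δ ^ 2)⁻¹) ^ 2 * ∫ p : ℝ × ℝ, mbDensity (L := L) (hubAt δ 1) ε p)
      {δ : ℝ | τ ≤ 4 * δ ^ 2 / (1 + δ ^ 2) ^ 2 ∧ τ ≤ (1 + δ ^ 2)⁻¹} := by
  have hpm0 : ∀ a : ℍ, 0 ≤ ∫ p : ℝ × ℝ, mbDensity (L := L) a ε p := fun a => integral_nonneg fun p => mbDensity_nonneg a ε p
  have hm2 : Measurable fun δ : ℝ => ((1 + δ ^ 2)⁻¹) ^ 2 * ∫ p : ℝ × ℝ, mbDensity (L := L) (hubAt δ 1) ε p :=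
    (((measurable_const.add (measurable_id.pow_const 2)).inv).pow_const 2).mul (measurable_planeMass_hubAt ε)
  refine ⟨hm2.aestronglyMeasurable.restrict, ?_⟩
  -- finiteness of the lintegral from the cone side
  have hfin : ∫⁻ a in HubBulk τ, ENNReal.ofReal (∫ p : ℝ × ℝ, mbDensity (L := L) a ε p) ∂coneMeasure < ⊤ := by
    have hI := integrableOn_integral_mbDensity_hubBulk (L := L) hε hτ hτ1
    have h := hI.2
    rw [hasFiniteIntegral_iff_norm] at h
    refine lt_of_le_of_lt (lintegral_mono fun a => ?_) h
    exact ENNReal.ofReal_le_ofReal (le_abs_self _ |>.trans (Real.norm_eq_abs _).symm.le)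
  rw [lintegral_planeMass_hubBulk_eq_hubCot ε τ] at hfin
  have hc : ENNReal.ofReal (coneConst * Real.pi) ≠ 0 := (ENNReal.ofReal_pos.2 (mul_pos coneConst_pos Real.pi_pos)).ne'
  have hfin' : ∫⁻ δ in {δ : ℝ | τ ≤ 4 * δ ^ 2 / (1 + δ ^ 2) ^ 2 ∧ τ ≤ (1 + δ ^ 2)⁻¹},
      ENNReal.ofReal (∫ p : ℝ × ℝ, mbDensity (L := L) (hubAt δ 1) ε p) * ENNReal.ofReal (((1 + δ ^ 2)⁻¹) ^ 2) < ⊤ := by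
    by_contra h
    rw [not_lt, top_le_iff] at h
    rw [h, ENNReal.mul_top hc] at hfin
    exact lt_irrefl _ hfin
  rw [hasFiniteIntegral_iff_norm]
  refine lt_of_le_of_lt (le_of_eq (lintegral_congr fun δ => ?_)) hfin'
  rw [Real.norm_eq_abs, abs_of_nonneg (mul_nonneg (by positivity) (hpm0 _)), ← ENNReal.ofReal_mul (hpm0 _), mul_comm]

/-- ★ **THE SHELL FLOOR**: for good `ε`, `0 < τ ≤ 1` and any measurable `S` inside the bulk window,
`coneConst·π·∫_S ((1+δ²)⁻¹)²·∫𝔪(hubAt δ 1, ε, ·) dδ ≤ ∫_{HubBulk τ}∫𝔪_ε dcone`. [folklore] -/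
theorem mbMain_ge_of_subset {ε : GnoSign L} (hε : GoodSign ε) {τ : ℝ} (hτ : 0 < τ) (hτ1 : τ ≤ 1) {S : Set ℝ}
    (hS : S ⊆ {δ : ℝ | τ ≤ 4 * δ ^ 2 / (1 + δ ^ 2) ^ 2 ∧ τ ≤ (1 + δ ^ 2)⁻¹}) :
    coneConst * Real.pi * ∫ δ in S, ((1 + δ ^ 2)⁻¹) ^ 2 * ∫ p : ℝ × ℝ, mbDensity (L := L) (hubAt δ 1) ε p ≤
      ∫ a in HubBulk τ, (∫ p : ℝ × ℝ, mbDensity (L := L) a ε p) ∂coneMeasure := by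
  have hpm0 : ∀ a : ℍ, 0 ≤ ∫ p : ℝ × ℝ, mbDensity (L := L) a ε p := fun a => integral_nonneg fun p => mbDensity_nonneg a ε p
  rw [setIntegral_planeMass_hubBulk_eq_hubCot ε τ]
  refine mul_le_mul_of_nonneg_left ?_ (mul_pos coneConst_pos Real.pi_pos).le
  exact setIntegral_mono_set (integrableOn_planeMass_hubCot hε hτ hτ1)
    (Filter.Eventually.of_forall fun δ => mul_nonneg (by positivity) (hpm0 _)) (Filter.Eventually.of_forall hS)

end Summit.QuantumFields.YangMills.Theorems.SwapVirialDeficit.SectorLaplace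

end
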